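import Summits.CriticalPhenomena.PercolationContinuityZ3.Theorems.PercNearOneGluingAdditiveGluingSetObserverMetaA2Prelim
import Mathlib.Combinatorics.SetFamily.FourFunctions
import HarnessLib

/-!
# Conjecture G / SET-W via a SET observer, XVII: META-A2 for a KILLED SET OBSERVER (the two-source induction behind (Htw-set))

Support file (`--supports stmt-CriticalPhenomena-4576`); no definitions, no named facts, no sorries.  Seat (b) V⁺-form `png-dp-vplus`, gen 13
(memo MEMO-gen12.md §4(d), §10 (H), §12).  Set-observer version of prim-hp-4's `CovTau.metaA2_of_star` / `CovTau.a2H` / `CovTau.p1H_univ`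
(`…NoHeavyLowerTailCovTauMetaA2.lean`, `…CovTauMetaA2Anti.lean`, `…CovTauA2H.lean`): the observer functional is `CovTau.EavSet`, the threshold
functional `X^O_F = Y_{q^O_A·F}` with `CovTau.qavSet`; the pure world functional `F` and `CovTau.Yw/Mav` are unchanged.
* **`metaA2Set_of_star`** — for `O ⊆ U` and all `N, N' ⊆ U`: `E^O_A(N)·Y_F(N') ≤ M_A(N ∪ N')·X^O_F(N ∩ N')`, given (★^F) and the antitonicity
  of `Y_F` in every sub-world.  The induction of `CovTau.metaA2_of_star` verbatim: base case `CovTau.setObs_twoSource_restrict`, inductive step by the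
  star decompositions (`CovTau.EavSet_step`, `Yw_step`, `Mav_step`), the product law of the neighbour set (`CovTau.sum_weight_rS`) and the
  Ahlswede–Daykin four functions theorem; observers inside `N` make `E^O_A(N)` vanish, so `O ⊆ U ∖ Z` is inherited.
* `metaA2Set`, `metaP1Set` — with the antitonicity discharged by `CovTau.Yw_antitone_of_le`; the diagonal.
* **`p1HSet_univ`** — (Htw-set) in abstract form on the whole graph with `F = H_{G[U']}(v) = Cov_{G[U']}(g(C_x), 1{v ↔ S})` (`CovTau.BfS`),
  inputs (★^H) `CovTauStarN.yS_mul_mS_le` and `CovTauStarN.yS_le_bS`.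
[cite: VandenbergHaggstromKahn2005, Thm. 1.1 (pp. 3–5), Thm. 1.3 (p. 6), Thm. 1.4 (p. 7)] [cite: Gladkov2024, Thm. 3.2 (p. 4)]
[cite: KozmaNitzan2024, Conj. 4 (p. 32)]
-/

noncomputable section

namespace Summit.CriticalPhenomena.PercolationContinuityZ3.Theorems.CovTau

open MeasureTheory
open Literature.Probability.LatticeModels (prodBernoulli)
open Literature.Probability.Percolation
open Literature.Probability.Percolation.BHK2006
open Literature.Probability.Percolation.DecisionTree (ind ind_of_mem ind_of_not_mem ind_nonneg)
open scoped Classical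

variable {V : Type*} [Fintype V]

/-! ### META-A2 for the killed set observer -/

/-- **META-A2 for a killed SET observer, modulo the one-source bounds** (set-observer version of `CovTau.metaA2_of_star`; memo §4(d) (Htw-set)).
Fix weights `w ∈ [0,1]` (normalised), an owner `x`, a vertex observer `v`, an observer SET `O`, an avoided set `A`, and a pure world functional
`F ≥ 0` with `F(U') = 0` whenever `v ∉ U'`.  If in every sub-world `U' ⊆ U` the one-source bound (★^F) `Y_F(N)·M_A(∅) ≤ M_A(N)·F(U')` holds and
`N ↦ Y_F(N)` is antitone, then for `O ⊆ U` and all `N, N' ⊆ U`: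
`E^O_A(N)·Y_F(N') ≤ M_A(N ∪ N')·X^O_F(N ∩ N')`, `X^O_F = Y_{q^O_A·F}`.  Proof = the induction of `CovTau.metaA2_of_star` verbatim, with the base case
`setObs_twoSource_restrict` and the star decomposition `EavSet_step` (observers inside `N` make `E^O_A(N)` vanish).
[cite: VandenbergHaggstromKahn2005, Thm. 1.1 (pp. 3–5), Thm. 1.3 (p. 6)] [cite: KozmaNitzan2024, Conj. 4 (p. 32)] -/
theorem metaA2Set_of_star (w : Sym2 V → ℝ) (hw0 : ∀ e, 0 ≤ w e) (hw1 : ∀ e, w e ≤ 1)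
    (hm : ∑ ω, weight w ω = 1) (x v : V) (O : Finset V) (A : Set V) {F : Finset V → ℝ}
    (hF0 : ∀ U' : Finset V, 0 ≤ F U') (hFv : ∀ U' : Finset V, v ∉ U' → F U' = 0) (U : Finset V)
    (hstar : ∀ U' ⊆ U, ∀ N : Set V, N ⊆ ↑U' →
      Yw w U' x F N * Mav w U' A v ∅ ≤ Mav w U' A v N * F U')
    (hanti : ∀ U' ⊆ U, ∀ N N' : Set V, N ⊆ N' → N' ⊆ ↑U' → Yw w U' x F N' ≤ Yw w U' x F N) :
    O ⊆ U → ∀ N N' : Set V, N ⊆ ↑U → N' ⊆ ↑U →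
      EavSet w U A O v N * Yw w U x F N' ≤
        Mav w U A v (N ∪ N') * Yw w U x (fun U' => qavSet w U' A O v * F U') (N ∩ N') := by
  induction U using Finset.strongInduction with
  | H U ih =>
  intro hOU N N' hNU hN'U
  have hqF0 : ∀ U' : Finset V, 0 ≤ qavSet w U' A O v * F U' := fun U' => mul_nonneg (qavSet_nonneg hw0 hw1 U' A O v) (hF0 U')
  have hRHS : 0 ≤ Mav w U A v (N ∪ N') * Yw w U x (fun U' => qavSet w U' A O v * F U') (N ∩ N') :=
    mul_nonneg (Mav_nonneg hw0 hw1 U A v _) (Yw_nonneg hw0 hw1 U x hqF0 _)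
  -- trivial cases
  by_cases hvN : v ∈ A ∪ N
  · rw [EavSet_eq_zero_of_mem w U A O v hvN, zero_mul]; exact hRHS
  have hvA : v ∉ A := fun h => hvN (Or.inl h)
  have hvN0 : v ∉ N := fun h => hvN (Or.inr h)
  by_cases hON : ∃ o ∈ O, o ∈ N
  · obtain ⟨o, ho, hoN⟩ := hON
    rw [EavSet_eq_zero_of_obs_mem w U A O v ho (Or.inr hoN), zero_mul]; exact hRHS
  have hON' : ∀ o ∈ O, o ∉ N := fun o ho hoN => hON ⟨o, ho, hoN⟩
  by_cases hxN' : x ∈ N'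
  · rw [Yw_eq_zero_of_mem w U x F hxN', mul_zero]; exact hRHS
  by_cases hvU : v ∈ U
  swap
  · rw [Yw_eq_zero_of_not_mem w x hFv hvU, mul_zero]; exact hRHS
  -- `Z := N ∩ N'`
  set Z : Finset V := U.filter fun u => u ∈ N ∧ u ∈ N' with hZ
  have hZU : Z ⊆ U := Finset.filter_subset _ _
  have hmemZ : ∀ u, u ∈ Z ↔ u ∈ N ∧ u ∈ N' := fun u => by
    simp only [hZ, Finset.mem_filter, and_iff_right_iff_imp]
    exact fun h => hNU h.1
  have hxZ : x ∉ Z := fun h => hxN' ((hmemZ x).1 h).2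
  have hvZ : v ∉ Z := fun h => hvN0 ((hmemZ v).1 h).1
  have hOZ : ∀ o ∈ O, o ∉ Z := fun o ho h => hON' o ho ((hmemZ o).1 h).1
  have hZN : (↑Z : Set V) ⊆ N := fun u hu => ((hmemZ u).1 hu).1
  have hZN' : (↑Z : Set V) ⊆ N' := fun u hu => ((hmemZ u).1 hu).2
  have hNN'Z : N ∩ N' = ↑Z := Set.ext fun u => by
    rw [Finset.mem_coe, hmemZ]; rfl
  rcases Z.eq_empty_or_nonempty with hZe | hZne
  · /- `N ∩ N' = ∅`: (★^F) for `N'` and the set two-source base in `G[U]`. -/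
    have hNN' : N ∩ N' = ∅ := by rw [hNN'Z, hZe, Finset.coe_empty]
    rw [hNN', Yw_empty w hm]
    have hq : qavSet w U A O v = EavSet w U A O v ∅ / Mav w U A v ∅ := by
      unfold qavSet; rw [if_pos hOU, one_mul]
    have hst := hstar U le_rfl N' hN'U
    have hcore := setObs_twoSource_restrict w hw0 hw1 U A O hvA N N'
    have hE := EavSet_nonneg hw0 hw1 U A O v N
    have hB := hF0 U
    have hM := Mav_nonneg hw0 hw1 U A v (N ∪ N')
    have hM0 := Mav_nonneg hw0 hw1 U A v (∅ : Set V)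
    have key : EavSet w U A O v N * Yw w U x F N' * Mav w U A v ∅ ≤
        Mav w U A v (N ∪ N') * (EavSet w U A O v ∅ * F U) :=
      calc EavSet w U A O v N * Yw w U x F N' * Mav w U A v ∅
          = EavSet w U A O v N * (Yw w U x F N' * Mav w U A v ∅) := by ring
        _ ≤ EavSet w U A O v N * (Mav w U A v N' * F U) := mul_le_mul_of_nonneg_left hst hE
        _ = (Mav w U A v N' * EavSet w U A O v N) * F U := by ring
        _ ≤ (EavSet w U A O v ∅ * Mav w U A v (N ∪ N')) * F U := mul_le_mul_of_nonneg_right hcore hB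
        _ = _ := by ring
    rcases hM0.eq_or_lt with hM0e | hM0p
    · -- `μ(v ↮ A) = 0`: then `E^O_A(N) = 0`
      have hE0 : EavSet w U A O v N = 0 := le_antisymm
        ((EavSet_le_Mav hw0 hw1 U A O v N).trans
          ((Mav_antitone hw0 hw1 U A v (Set.empty_subset N)).trans hM0e.symm.le)) hE
      rw [hE0, zero_mul]
      exact mul_nonneg hM (mul_nonneg (qavSet_nonneg hw0 hw1 U A O v) hB)
    · rw [hq]
      calc EavSet w U A O v N * Yw w U x F N'
          = EavSet w U A O v N * Yw w U x F N' * Mav w U A v ∅ / Mav w U A v ∅ := by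
            field_simp
        _ ≤ Mav w U A v (N ∪ N') * (EavSet w U A O v ∅ * F U) / Mav w U A v ∅ :=
            div_le_div_of_nonneg_right key hM0p.le
        _ = Mav w U A v (N ∪ N') * (EavSet w U A O v ∅ / Mav w U A v ∅ * F U) := by
            field_simp
  · /- `Z ≠ ∅`: condition on the neighbour set `S` of `Z`, push forward to its product law, and apply the
    four functions theorem with the induction hypothesis on `U ∖ Z`. -/
    have hss : U \ Z ⊂ U := Finset.sdiff_ssubset hZU hZne
    have hU'U : U \ Z ⊆ U := Finset.sdiff_subset
    have hZNN' : (↑Z : Set V) ⊆ N ∪ N' := hZN.trans Set.subset_union_left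
    have hOUZ : O ⊆ U \ Z := fun o ho => Finset.mem_sdiff.2 ⟨hOU ho, hOZ o ho⟩
    -- star decompositions
    have eE := EavSet_step hZU (A := A) hZN hOZ w hm v
    have eY := Yw_step hZU hxZ hZN' w hm F
    have eM := Mav_step hZU hvU hvZ (A := A) hZNN' w hm
    have eX : Yw w U x (fun U' => qavSet w U' A O v * F U') (N ∩ N') =
        ∑ ω, weight w ω * Yw w (U \ Z) x (fun U' => qavSet w U' A O v * F U') (rS U Z ω) := by
      rw [hNN'Z, Yw_step hZU hxZ (subset_refl _) w hm (fun U' => qavSet w U' A O v * F U')]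
      simp only [Set.sdiff_self, Set.empty_union]
    -- the four functionals on the lattice `Set V`
    set e : Set V → ℝ := fun η => EavSet w (U \ Z) A O v (N \ ↑Z ∪ (η ∩ ↑(U \ Z))) with he
    set y : Set V → ℝ := fun η => Yw w (U \ Z) x F (N' \ ↑Z ∪ (η ∩ ↑(U \ Z))) with hy
    set m : Set V → ℝ := fun η => Mav w (U \ Z) A v ((N ∪ N') \ ↑Z ∪ (η ∩ ↑(U \ Z))) with hm'
    set χ : Set V → ℝ := fun η => Yw w (U \ Z) x (fun U' => qavSet w U' A O v * F U') (η ∩ ↑(U \ Z)) with hχ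
    set wp : Set V → ℝ := weight (pZ w U Z) with hwp
    have hrSU : ∀ ω : Set (Sym2 V), rS U Z ω ∩ ↑(U \ Z) = rS U Z ω := fun ω =>
      Set.inter_eq_left.2 (rS_subset U Z ω)
    have hE' : EavSet w U A O v N = ∑ η, wp η * e η := by
      rw [eE, ← sum_weight_rS hm U Z e]
      refine Finset.sum_congr rfl fun ω _ => ?_
      simp only [he, hrSU]
    have hY' : Yw w U x F N' = ∑ η, wp η * y η := by
      rw [eY, ← sum_weight_rS hm U Z y]
      refine Finset.sum_congr rfl fun ω _ => ?_
      simp only [hy, hrSU]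
    have hM' : Mav w U A v (N ∪ N') = ∑ η, wp η * m η := by
      rw [eM, ← sum_weight_rS hm U Z m]
      refine Finset.sum_congr rfl fun ω _ => ?_
      simp only [hm', hrSU]
    have hX' : Yw w U x (fun U' => qavSet w U' A O v * F U') (N ∩ N') = ∑ η, wp η * χ η := by
      rw [eX, ← sum_weight_rS hm U Z χ]
      refine Finset.sum_congr rfl fun ω _ => ?_
      simp only [hχ, hrSU]
    -- nonnegativity
    have hp0 : ∀ u, 0 ≤ pZ w U Z u := fun u => (pZ_mem hw0 hw1 hm U Z u).1
    have hp1 : ∀ u, pZ w U Z u ≤ 1 := fun u => (pZ_mem hw0 hw1 hm U Z u).2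
    have hwp0 : ∀ η, 0 ≤ wp η := fun η => weight_nonneg hp0 hp1 η
    have he0 : ∀ η, 0 ≤ e η := fun η => EavSet_nonneg hw0 hw1 _ A O v _
    have hy0 : ∀ η, 0 ≤ y η := fun η => Yw_nonneg hw0 hw1 _ x hF0 _
    have hm0 : ∀ η, 0 ≤ m η := fun η => Mav_nonneg hw0 hw1 _ A v _
    have hχ0 : ∀ η, 0 ≤ χ η := fun η => Yw_nonneg hw0 hw1 _ x hqF0 _
    -- hypotheses restricted to `(U \ Z)`
    have hstar' : ∀ U'' ⊆ (U \ Z), ∀ N : Set V, N ⊆ ↑U'' →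
        Yw w U'' x F N * Mav w U'' A v ∅ ≤ Mav w U'' A v N * F U'' :=
      fun U'' hU'' => hstar U'' (hU''.trans hU'U)
    have hanti' : ∀ U'' ⊆ (U \ Z), ∀ N N' : Set V, N ⊆ N' → N' ⊆ ↑U'' → Yw w U'' x F N' ≤ Yw w U'' x F N :=
      fun U'' hU'' => hanti U'' (hU''.trans hU'U)
    have IH := ih (U \ Z) hss hstar' hanti' hOUZ
    have keyZ : ∀ u, u ∈ N → u ∈ N' → u ∈ (↑Z : Set V) := fun u h1 h2 => (hmemZ u).2 ⟨h1, h2⟩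
    rw [hE', hY', hM', hX', mul_comm (∑ η, wp η * m η)]
    refine four_functions_theorem_univ (fun η => wp η * e η) (fun η => wp η * y η)
      (fun η => wp η * χ η) (fun η => wp η * m η)
      (fun η => mul_nonneg (hwp0 η) (he0 η)) (fun η => mul_nonneg (hwp0 η) (hy0 η))
      (fun η => mul_nonneg (hwp0 η) (hχ0 η)) (fun η => mul_nonneg (hwp0 η) (hm0 η)) fun a b => ?_
    -- the Ahlswede–Daykin hypothesis from the induction hypothesis at the pair `(P̃, P̃')`
    set S' : Set V := a ∩ ↑(U \ Z) with hS'
    set T' : Set V := b ∩ ↑(U \ Z) with hT'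
    set P : Set V := S' ∪ (N \ ↑Z) \ T' with hP
    set P' : Set V := T' ∪ (N' \ ↑Z) \ S' with hP'
    have hPU : P ⊆ ↑(U \ Z) := by
      rintro u (hu | ⟨⟨huN, huZ⟩, -⟩)
      · exact hu.2
      · rw [Finset.coe_sdiff]; exact ⟨hNU huN, huZ⟩
    have hP'U : P' ⊆ ↑(U \ Z) := by
      rintro u (hu | ⟨⟨huN, huZ⟩, -⟩)
      · exact hu.2
      · rw [Finset.coe_sdiff]; exact ⟨hN'U huN, huZ⟩
    have hIH := IH P P' hPU hP'U
    have h1 : e a ≤ EavSet w (U \ Z) A O v P :=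
      EavSet_antitone hw0 hw1 (U \ Z) A O v (show P ⊆ N \ ↑Z ∪ S' from by
        rintro u (hu | ⟨hu, -⟩); exacts [Or.inr hu, Or.inl hu])
    have h2 : y b ≤ Yw w (U \ Z) x F P' :=
      hanti (U \ Z) hU'U P' (N' \ ↑Z ∪ T') (by rintro u (hu | ⟨hu, -⟩); exacts [Or.inr hu, Or.inl hu])
        (by
          rintro u (⟨huN, huZ⟩ | hu)
          · rw [Finset.coe_sdiff]; exact ⟨hN'U huN, huZ⟩
          · exact hu.2)
    have hunion : P ∪ P' = (N ∪ N') \ ↑Z ∪ ((a ∪ b) ∩ ↑(U \ Z)) := by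
      ext u
      constructor
      · rintro ((hS | ⟨hA, -⟩) | (hT | ⟨hA', -⟩))
        · exact Or.inr ⟨Or.inl hS.1, hS.2⟩
        · exact Or.inl ⟨Or.inl hA.1, hA.2⟩
        · exact Or.inr ⟨Or.inr hT.1, hT.2⟩
        · exact Or.inl ⟨Or.inr hA'.1, hA'.2⟩
      · rintro (⟨hN | hN', hZ'⟩ | ⟨ha | hb, hU⟩)
        · by_cases hT : u ∈ T'
          · exact Or.inr (Or.inl hT)
          · exact Or.inl (Or.inr ⟨⟨hN, hZ'⟩, hT⟩)
        · by_cases hS : u ∈ S'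
          · exact Or.inl (Or.inl hS)
          · exact Or.inr (Or.inr ⟨⟨hN', hZ'⟩, hS⟩)
        · exact Or.inl (Or.inl ⟨ha, hU⟩)
        · exact Or.inr (Or.inl ⟨hb, hU⟩)
    have hinter : P ∩ P' = (a ∩ b) ∩ ↑(U \ Z) := by
      ext u
      constructor
      · rintro ⟨hS | ⟨⟨hN, hZ'⟩, hT⟩, hT' | ⟨⟨hN', -⟩, hS'⟩⟩
        · exact ⟨⟨hS.1, hT'.1⟩, hS.2⟩
        · exact absurd hS hS'
        · exact absurd hT' hT
        · exact absurd (keyZ u hN hN') hZ'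
      · rintro ⟨⟨ha, hb⟩, hU⟩
        exact ⟨Or.inl ⟨ha, hU⟩, Or.inl ⟨hb, hU⟩⟩
    have h3 : e a * y b ≤ m (a ∪ b) * χ (a ∩ b) :=
      calc e a * y b ≤ EavSet w (U \ Z) A O v P * Yw w (U \ Z) x F P' :=
            mul_le_mul h1 h2 (hy0 b) (EavSet_nonneg hw0 hw1 _ A O v _)
        _ ≤ Mav w (U \ Z) A v (P ∪ P') * Yw w (U \ Z) x (fun U' => qavSet w U' A O v * F U') (P ∩ P') := hIH
        _ = m (a ∪ b) * χ (a ∩ b) := by rw [hunion, hinter]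
    have hwab := weight_inter_mul_union (pZ w U Z) a b
    show wp a * e a * (wp b * y b) ≤ wp (a ∩ b) * χ (a ∩ b) * (wp (a ∪ b) * m (a ∪ b))
    calc wp a * e a * (wp b * y b) = (wp a * wp b) * (e a * y b) := by ring
      _ ≤ (wp (a ∩ b) * wp (a ∪ b)) * (m (a ∪ b) * χ (a ∩ b)) := by
          rw [hwp, hwab]
          exact mul_le_mul_of_nonneg_left h3 (mul_nonneg (hwp0 _) (hwp0 _))
      _ = _ := by ring

/-- **META-A2 for a killed set observer modulo (★^F) and `Y_F({u}) ≤ F`** (as `CovTau.metaA2`).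
[cite: VandenbergHaggstromKahn2005, Thm. 1.1 (pp. 3–5)] -/
theorem metaA2Set (w : Sym2 V → ℝ) (hw0 : ∀ e, 0 ≤ w e) (hw1 : ∀ e, w e ≤ 1)
    (hm : ∑ ω, weight w ω = 1) (x v : V) (O : Finset V) (A : Set V) {F : Finset V → ℝ}
    (hF0 : ∀ U' : Finset V, 0 ≤ F U') (hFv : ∀ U' : Finset V, v ∉ U' → F U' = 0) (U : Finset V)
    (hstar : ∀ U' ⊆ U, ∀ N : Set V, N ⊆ ↑U' →
      Yw w U' x F N * Mav w U' A v ∅ ≤ Mav w U' A v N * F U')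
    (hYB : ∀ U' ⊆ U, ∀ u : V, Yw w U' x F {u} ≤ F U') (hOU : O ⊆ U) {N N' : Set V} (hNU : N ⊆ ↑U) (hN'U : N' ⊆ ↑U) :
    EavSet w U A O v N * Yw w U x F N' ≤
      Mav w U A v (N ∪ N') * Yw w U x (fun U' => qavSet w U' A O v * F U') (N ∩ N') :=
  metaA2Set_of_star w hw0 hw1 hm x v O A hF0 hFv U hstar
    (fun U' hU' _ _ hNN' hN'U' => Yw_antitone_of_le w hw0 hw1 hm x F U' (fun U'' hU'' u => hYB U'' (hU''.trans hU') u) hNN' hN'U')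
    hOU N N' hNU hN'U

/-- **The diagonal (Htw-set in abstract form)**: `E^O_A(Y)·Y_F(Y) ≤ M_A(Y)·X^O_F(Y)`. [cite: VandenbergHaggstromKahn2005, Thm. 1.1 (pp. 3–5)] -/
theorem metaP1Set (w : Sym2 V → ℝ) (hw0 : ∀ e, 0 ≤ w e) (hw1 : ∀ e, w e ≤ 1)
    (hm : ∑ ω, weight w ω = 1) (x v : V) (O : Finset V) (A : Set V) {F : Finset V → ℝ}
    (hF0 : ∀ U' : Finset V, 0 ≤ F U') (hFv : ∀ U' : Finset V, v ∉ U' → F U' = 0) (U : Finset V)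
    (hstar : ∀ U' ⊆ U, ∀ N : Set V, N ⊆ ↑U' →
      Yw w U' x F N * Mav w U' A v ∅ ≤ Mav w U' A v N * F U')
    (hYB : ∀ U' ⊆ U, ∀ u : V, Yw w U' x F {u} ≤ F U') (hOU : O ⊆ U) {Y : Set V} (hY : Y ⊆ ↑U) :
    EavSet w U A O v Y * Yw w U x F Y ≤ Mav w U A v Y * Yw w U x (fun U' => qavSet w U' A O v * F U') Y := by
  have h := metaA2Set w hw0 hw1 hm x v O A hF0 hFv U hstar hYB hOU hY hY
  simpa only [Set.union_self, Set.inter_self] using h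

/-- **(Htw-set) with the covariance functional `H_{G[U']}(v) = Cov_{G[U']}(g(C_x), 1{v ↔ S})` on the whole graph** (set-observer version of
`CovTau.p1H_univ`): for a marker set `S ∋ x` with `v ∉ S`, a monotone edge-cluster functional `g ≥ 0`, an observer set `O` and every `Y`,
`E^O_S(Y)·Y^H(Y) ≤ M_S(Y)·X^{O,H}(Y)` in `G = G[univ]` (inputs (★^H), `Y^H ≤ H` of prim-ineq-prove-1, as in `CovTau.a2H`).
[cite: VandenbergHaggstromKahn2005, Thm. 1.1 (pp. 3–5), Thm. 1.4 (p. 7)] [cite: Gladkov2024, Thm. 3.2 (p. 4)] -/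
theorem p1HSet_univ (w : Sym2 V → ℝ) (hw0 : ∀ e, 0 ≤ w e) (hw1 : ∀ e, w e ≤ 1) (hm : ∑ ω, weight w ω = 1)
    {x v : V} {S : Set V} (hxS : x ∈ S) (hvS : v ∉ S) (O : Finset V) {g : Set (Sym2 V) → ℝ} (hg : Monotone g)
    (hg0 : ∀ C, 0 ≤ g C) (Y : Set V) :
    EavSet w Finset.univ S O v Y * Yw w Finset.univ x (fun U' => BfS w U' x S v g) Y ≤
      Mav w Finset.univ S v Y *
        Yw w Finset.univ x (fun U' => qavSet w U' S O v * BfS w U' x S v g) Y :=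
  metaP1Set w hw0 hw1 hm x v O S (F := fun U' => BfS w U' x S v g)
    (fun U' => BfS_nonneg hw0 hw1 hm U' x S v hg hg0) (fun _ hv => BfS_eq_zero_of_not_mem w x hv hvS g) Finset.univ
    (fun U' _ N _ => CovTauStarN.yS_mul_mS_le w hw0 hw1 hxS hvS hg hg0 U' N)
    (fun U' _ u => CovTauStarN.yS_le_bS w hw0 hw1 x hvS hg hg0 U' {u}) (Finset.subset_univ O) (Set.subset_univ _ |>.trans (by simp))

end Summit.CriticalPhenomena.PercolationContinuityZ3.Theorems.CovTau

end
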